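/-
Copyright (c) 2026. All rights reserved.
Released under Apache 2.0 license as described in the file LICENSE.
Authors: abc-iut cell, prover seat abc-iut-f-072 (gen 12).
-/
import Mathlib.NumberTheory.NumberField.Basic
import Mathlib.NumberTheory.RamificationInertia.Basic
import Mathlib.RingTheory.RamificationInertia.Ramification
import Mathlib.RingTheory.RamificationInertia.Inertia
import Mathlib.RingTheory.DedekindDomain.AdicValuation
import Mathlib.RingTheory.Ideal.Norm.AbsNorm
import Mathlib.LinearAlgebra.FreeModule.IdealQuotient
import Mathlib.RingTheory.AdjoinRoot
import Mathlib.Data.ZMod.QuotientRing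
import HarnessLib

/-!
# The local model of `𝓞_F` at a prime of ramification `(e, f) = (2, 1)`: `𝓞_F / 𝔭^{2k} ≅ (ℤ/p^k)[X]/(X² − c)`

Classical algebraic number theory (no definition, no `Prop` fact, no instance; Mathlib only).  Let `F` be a
number field, `𝔭` a prime of `𝓞_F` over the rational prime `p` with ramification index `e = 2` and residue
degree `f = 1`, and suppose `θ ∈ 𝓞_F` satisfies `θ² ≡ c (mod 𝔭^{2k})` for an integer `c`, with `θ − t` a
uniformizer at `𝔭` for some integer `t` (`θ − t ∈ 𝔭 ∖ 𝔭²`).  Then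

* `exists_intCast_sub_mem_of_absNorm_eq` — (`f = 1`) every element of `𝓞_F` is congruent to a rational
  integer mod `𝔭`;
* `pow_succ_sup_span_pow_eq` — (`π` a uniformizer) `𝔭^{m+1} + (π^m) = 𝔭^m`;
* `exists_poly_sub_mem_pow` — every `x ∈ 𝓞_F` is congruent mod `𝔭^m` to an integer polynomial in `π`
  (`𝓞_F/𝔭^m = ℤ[π̄]`), for every `m`;
* `natCast_mem_sq_of_ramificationIdx_eq_two` — `p ∈ 𝔭²`;
* `natCard_quotient_pow_eq` — `#(𝓞_F/𝔭^m) = p^m`;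
* **`exists_ringEquiv_adjoinRoot_quotient_pow`** — a ring isomorphism
  `(ℤ/p^k)[X]/(X² − c) ≃ 𝓞_F/𝔭^{2k}` sending `X ↦ θ` and integers to integers.

This is the explicit local structure of a quadratically ramified prime with trivial residue extension
(Serre, *Local Fields*, I §6 Prop. 18: `𝓞_L = 𝓞_K[π]` for totally ramified extensions; Neukirch II (6.8),
I (8.3)); it is the input of the discriminant-congruence argument `d_F ≡ (4c)^a · u² (mod p^k)`.
[cite: NeukirchANT1999, Ch. I §8 (8.2)–(8.3) and Ch. II §6 (6.8)]
-/

namespace Literature.NumberTheory.NumberFields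

open NumberField IsDedekindDomain Polynomial UniqueFactorizationMonoid

variable {F : Type*} [Field F] [NumberField F]

/-! ## 1. Residue degree one: integers represent residues -/

/-- If `N(𝔭) = p` is prime and `p ∈ 𝔭`, every `x ∈ 𝓞_F` is congruent mod `𝔭` to a rational integer
(`𝓞_F/𝔭 = 𝔽_p`). [cite: NeukirchANT1999, Ch. I §8 (8.2)–(8.3)] -/
theorem exists_intCast_sub_mem_of_absNorm_eq (v : HeightOneSpectrum (𝓞 F)) {p : ℕ} (hp : p.Prime)
    (hN : Ideal.absNorm v.asIdeal = p) (hv : (p : 𝓞 F) ∈ v.asIdeal) (x : 𝓞 F) :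
    ∃ n : ℤ, x - n ∈ v.asIdeal := by
  classical
  haveI := v.isMaximal
  haveI : Fact p.Prime := ⟨hp⟩
  haveI : Finite (𝓞 F ⧸ v.asIdeal) := Ideal.finiteQuotientOfFreeOfNeBot v.asIdeal v.ne_bot
  have hcard : Nat.card (𝓞 F ⧸ v.asIdeal) = p := by
    rw [← Submodule.cardQuot_apply, ← Ideal.absNorm_apply, hN]
  letI : Field (𝓞 F ⧸ v.asIdeal) := Ideal.Quotient.field v.asIdeal
  have hp0 : ((p : ℕ) : 𝓞 F ⧸ v.asIdeal) = 0 := by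
    rw [← map_natCast (Ideal.Quotient.mk v.asIdeal), Ideal.Quotient.eq_zero_iff_mem]
    exact hv
  haveI hchar : CharP (𝓞 F ⧸ v.asIdeal) p := by
    obtain ⟨q, hq⟩ := CharP.exists (𝓞 F ⧸ v.asIdeal)
    haveI := hq
    have hqprime : q.Prime := CharP.char_is_prime (𝓞 F ⧸ v.asIdeal) q
    have hqp : q ∣ p := (CharP.cast_eq_zero_iff _ q p).mp hp0
    have : q = p := (Nat.prime_dvd_prime_iff_eq hqprime hp).mp hqp
    subst this
    exact hq
  let φ : ZMod p →+* 𝓞 F ⧸ v.asIdeal := ZMod.castHom (dvd_refl p) (𝓞 F ⧸ v.asIdeal)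
  haveI : Fintype (𝓞 F ⧸ v.asIdeal) := Fintype.ofFinite _
  have hbij : Function.Bijective φ := by
    refine (Fintype.bijective_iff_injective_and_card φ).mpr ⟨φ.injective, ?_⟩
    rw [ZMod.card, ← Nat.card_eq_fintype_card, hcard]
  obtain ⟨a, ha⟩ := hbij.2 (Ideal.Quotient.mk v.asIdeal x)
  refine ⟨(a.val : ℤ), ?_⟩
  rw [← Ideal.Quotient.eq_zero_iff_mem, map_sub, ← ha, sub_eq_zero, map_intCast, Int.cast_natCast]
  conv_lhs => rw [← ZMod.natCast_zmod_val a]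
  rw [map_natCast]

/-! ## 2. Uniformizers and the structure `𝓞_F/𝔭^m = ℤ[π̄]` -/

/-- For a uniformizer `π ∈ 𝔭 ∖ 𝔭²`: the multiplicity of `𝔭` in `(π^m)` is `m`.
[cite: NeukirchANT1999, Ch. I §8 (8.2)–(8.3)] -/
theorem emultiplicity_span_pow_eq (v : HeightOneSpectrum (𝓞 F)) {π : 𝓞 F} (h1 : π ∈ v.asIdeal)
    (h2 : π ∉ v.asIdeal ^ 2) (m : ℕ) : emultiplicity v.asIdeal (Ideal.span {π ^ m}) = m := by
  have hone : emultiplicity v.asIdeal (Ideal.span {π}) = 1 := by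
    rw [show (1 : ℕ∞) = ((1 : ℕ) : ℕ∞) from rfl, emultiplicity_eq_coe, pow_one,
      Ideal.dvd_iff_le, Ideal.dvd_iff_le, Ideal.span_singleton_le_iff_mem, Ideal.span_singleton_le_iff_mem]
    exact ⟨h1, h2⟩
  rw [← Ideal.span_singleton_pow, emultiplicity_pow v.prime, hone, mul_one]

/-- **Peeling one step**: `𝔭^{m+1} + (π^m) = 𝔭^m` for a uniformizer `π`.
[cite: NeukirchANT1999, Ch. I §8 (8.2)–(8.3)] -/
theorem pow_succ_sup_span_pow_eq (v : HeightOneSpectrum (𝓞 F)) {π : 𝓞 F} (h1 : π ∈ v.asIdeal)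
    (h2 : π ∉ v.asIdeal ^ 2) (m : ℕ) :
    v.asIdeal ^ (m + 1) ⊔ Ideal.span {π ^ m} = v.asIdeal ^ m := by
  have hπ0 : π ≠ 0 := by rintro rfl; exact h2 (Ideal.zero_mem _)
  have hI : Ideal.span {π ^ m} ≠ ⊥ := by
    rw [ne_eq, Ideal.span_singleton_eq_bot]; exact pow_ne_zero _ hπ0
  have hem := emultiplicity_span_pow_eq v h1 h2 m
  have hmul : multiplicity v.asIdeal (Ideal.span {π ^ m}) = m := multiplicity_eq_of_emultiplicity_eq_some hem
  rw [Ideal.irreducible_pow_sup_of_ge hI v.irreducible (m + 1) (by rw [hem]; exact_mod_cast Nat.le_succ m), hmul]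

/-- **`𝓞_F/𝔭^m = ℤ[π̄]`**: if the residues are represented by integers (`f = 1`) and `π` is a uniformizer, every
`x ∈ 𝓞_F` is congruent modulo `𝔭^m` to `P(π)` for an integer polynomial `P`, for every `m`.
[cite: NeukirchANT1999, Ch. II §6 (6.8)] -/
theorem exists_poly_sub_mem_pow (v : HeightOneSpectrum (𝓞 F))
    (hres : ∀ x : 𝓞 F, ∃ n : ℤ, x - n ∈ v.asIdeal) {π : 𝓞 F} (h1 : π ∈ v.asIdeal) (h2 : π ∉ v.asIdeal ^ 2)
    (m : ℕ) (x : 𝓞 F) : ∃ P : ℤ[X], x - aeval π P ∈ v.asIdeal ^ m := by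
  induction m with
  | zero => exact ⟨0, by rw [pow_zero, Ideal.one_eq_top]; exact Submodule.mem_top⟩
  | succ m ih =>
    obtain ⟨P, hP⟩ := ih
    rw [← pow_succ_sup_span_pow_eq v h1 h2 m, Submodule.mem_sup] at hP
    obtain ⟨y, hy, z, hz, hyz⟩ := hP
    obtain ⟨w, rfl⟩ := Ideal.mem_span_singleton'.mp hz
    obtain ⟨n, hn⟩ := hres w
    refine ⟨P + C n * X ^ m, ?_⟩
    have hid : x - aeval π (P + C n * X ^ m) = y + (w - n) * π ^ m := by
      rw [map_add, map_mul, aeval_C, map_pow, aeval_X, algebraMap_int_eq, eq_intCast]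
      linear_combination (-1 : 𝓞 F) * hyz
    rw [hid, pow_succ]
    exact Submodule.add_mem _ hy (Ideal.mul_mem_mul hn (Ideal.pow_mem_pow h1 m) |> fun h => by
      rwa [mul_comm (v.asIdeal) _] at h)

/-! ## 3. A prime with `e = 2`, `f = 1` over `p` -/

/-- A prime `𝔭` with `p ∈ 𝔭` lies over `(p)`. [cite: NeukirchANT1999, Ch. I §8 (8.2)–(8.3)] -/
theorem liesOver_span_natCast_of_mem (v : HeightOneSpectrum (𝓞 F)) {p : ℕ} (hp : p.Prime)
    (hv : (p : 𝓞 F) ∈ v.asIdeal) : v.asIdeal.LiesOver (Ideal.span {(p : ℤ)}) := by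
  refine ⟨?_⟩
  haveI := v.isMaximal
  have hmax : (Ideal.span {(p : ℤ)}).IsMaximal :=
    Ideal.IsPrime.isMaximal (by rw [Ideal.span_singleton_prime (by exact_mod_cast hp.ne_zero)]; exact_mod_cast
      Nat.prime_iff_prime_int.mp hp) (by simp [hp.ne_zero])
  refine (hmax.eq_of_le (Ideal.comap_ne_top _ (Ideal.IsMaximal.ne_top inferInstance)) ?_)
  rw [Ideal.span_singleton_le_iff_mem, Ideal.mem_comap, map_natCast]
  exact hv

/-- `e(𝔭|p) = 2 ⇒ p ∈ 𝔭²`. [cite: NeukirchANT1999, Ch. I §8 (8.2)–(8.3)] -/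
theorem natCast_mem_sq_of_ramificationIdx_eq_two (v : HeightOneSpectrum (𝓞 F)) {p : ℕ} (hp : p.Prime)
    (hv : (p : 𝓞 F) ∈ v.asIdeal) (he : v.asIdeal.ramificationIdx ℤ = 2) : (p : 𝓞 F) ∈ v.asIdeal ^ 2 := by
  haveI := liesOver_span_natCast_of_mem v hp hv
  have hp0 : Ideal.map (algebraMap ℤ (𝓞 F)) (Ideal.span {(p : ℤ)}) ≠ ⊥ := by
    rw [Ideal.map_span, Set.image_singleton, ne_eq, Ideal.span_singleton_eq_bot, map_natCast]
    exact_mod_cast hp.ne_zero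
  have hmult := Ideal.IsDedekindDomain.ramificationIdx_eq_multiplicity (Ideal.span {(p : ℤ)}) v.asIdeal hp0
  have hdvd := pow_multiplicity_dvd v.asIdeal (Ideal.map (algebraMap ℤ (𝓞 F)) (Ideal.span {(p : ℤ)}))
  rw [← hmult, he, Ideal.dvd_iff_le] at hdvd
  apply hdvd
  rw [Ideal.map_span, Set.image_singleton, map_natCast]
  exact Ideal.mem_span_singleton_self _

/-- `f(𝔭|p) = 1 ⇒ N(𝔭) = p`. [cite: NeukirchANT1999, Ch. I §8 (8.2)–(8.3)] -/
theorem absNorm_eq_of_inertiaDeg_eq_one (v : HeightOneSpectrum (𝓞 F)) {p : ℕ} (hp : p.Prime)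
    (hv : (p : 𝓞 F) ∈ v.asIdeal) (hf : v.asIdeal.inertiaDeg ℤ = 1) : Ideal.absNorm v.asIdeal = p := by
  haveI := liesOver_span_natCast_of_mem v hp hv
  haveI := v.isPrime
  have h := Ideal.pow_inertiaDeg p v.asIdeal
  rw [hf, pow_one] at h
  exact h.symm

/-- `#(𝓞_F/𝔭^m) = N(𝔭)^m = p^m` when `f = 1`. [cite: NeukirchANT1999, Ch. I §8 (8.2)–(8.3)] -/
theorem natCard_quotient_pow_eq (v : HeightOneSpectrum (𝓞 F)) {p : ℕ} (hp : p.Prime)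
    (hv : (p : 𝓞 F) ∈ v.asIdeal) (hf : v.asIdeal.inertiaDeg ℤ = 1) (m : ℕ) :
    Nat.card (𝓞 F ⧸ v.asIdeal ^ m) = p ^ m := by
  rw [← Submodule.cardQuot_apply, ← Ideal.absNorm_apply, map_pow, absNorm_eq_of_inertiaDeg_eq_one v hp hv hf]

/-! ## 4. The local model `(ℤ/p^k)[X]/(X² − c) ≅ 𝓞_F/𝔭^{2k}` -/

/-- `X² − c` is monic over any commutative ring (local copy for the model). [cite: NeukirchANT1999, Ch. II §6 (6.8)] -/
theorem monic_X_sq_sub_C' {A : Type*} [CommRing A] (c : A) : (X ^ 2 - C c : A[X]).Monic :=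
  monic_X_pow_sub_C c two_ne_zero

/-- `ℤ/(q)` is nontrivial for `q > 1`. [cite: NeukirchANT1999, Ch. I §8 (8.2)–(8.3)] -/
theorem nontrivial_int_quotient_span_natCast {q : ℕ} (hq : 1 < q) : Nontrivial (ℤ ⧸ Ideal.span {(q : ℤ)}) := by
  refine Ideal.Quotient.nontrivial_iff.mpr ?_
  rw [Ne, Ideal.span_singleton_eq_top, Int.isUnit_iff]
  omega

/-- `#((ℤ/q)[X]/(X² − c)) = q²` (`q > 1`). [cite: NeukirchANT1999, Ch. II §6 (6.8)] -/
theorem natCard_adjoinRoot_sq_sub {q : ℕ} (hq : 1 < q) (c : ℤ ⧸ Ideal.span {(q : ℤ)}) :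
    Nat.card (AdjoinRoot (X ^ 2 - C c : (ℤ ⧸ Ideal.span {(q : ℤ)})[X])) = q ^ 2 := by
  classical
  haveI := nontrivial_int_quotient_span_natCast hq
  haveI : NeZero q := ⟨by omega⟩
  haveI : Finite (ℤ ⧸ Ideal.span {(q : ℤ)}) := Finite.of_equiv _ (Int.quotientSpanNatEquivZMod q).toEquiv.symm
  let pb := AdjoinRoot.powerBasis' (monic_X_sq_sub_C' c)
  have hdim : pb.dim = 2 := by rw [AdjoinRoot.powerBasis'_dim, natDegree_X_pow_sub_C]
  rw [Nat.card_congr pb.basis.equivFun.toEquiv, Nat.card_fun,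
    Nat.card_congr (Int.quotientSpanNatEquivZMod q).toEquiv, Nat.card_zmod, Nat.card_eq_fintype_card,
    Fintype.card_fin, hdim]

/-- **The local model of a `(2,1)`-ramified prime.**  Let `𝔭 ∣ p` have `e = 2`, `f = 1`; let `θ ∈ 𝓞_F` with
`θ² ≡ c (mod 𝔭^{2k})` (`c ∈ ℤ`) and `θ − t` a uniformizer at `𝔭` (`t ∈ ℤ`).  Then `X ↦ θ` induces a ring
isomorphism `(ℤ/p^k)[X]/(X² − c) ≅ 𝓞_F/𝔭^{2k}` fixing the integers: it is well defined since `p^k ∈ 𝔭^{2k}` and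
`θ̄² = c̄`, surjective because `𝓞_F/𝔭^{2k} = ℤ[θ̄ − t]` (`exists_poly_sub_mem_pow`), and bijective by counting
(`p^{2k}` elements on both sides). [cite: NeukirchANT1999, Ch. II §6 (6.8)] -/
theorem exists_ringEquiv_adjoinRoot_quotient_pow (v : HeightOneSpectrum (𝓞 F)) {p : ℕ} (hp : p.Prime)
    (hv : (p : 𝓞 F) ∈ v.asIdeal) (he : v.asIdeal.ramificationIdx ℤ = 2) (hf : v.asIdeal.inertiaDeg ℤ = 1)
    {k : ℕ} (hk : k ≠ 0) (c t : ℤ) (θ : 𝓞 F) (hθ : θ ^ 2 - c ∈ v.asIdeal ^ (2 * k))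
    (hu1 : θ - t ∈ v.asIdeal) (hu2 : θ - t ∉ v.asIdeal ^ 2) :
    ∃ e : AdjoinRoot (X ^ 2 - C (Ideal.Quotient.mk (Ideal.span {((p ^ k : ℕ) : ℤ)}) c)) ≃+*
        𝓞 F ⧸ v.asIdeal ^ (2 * k),
      e (AdjoinRoot.root _) = Ideal.Quotient.mk _ θ ∧ ∀ n : ℤ, e n = n := by
  classical
  have hq1 : 1 < p ^ k := Nat.one_lt_pow hk hp.one_lt
  haveI := nontrivial_int_quotient_span_natCast hq1
  -- (i) `p^k ∈ 𝔭^{2k}`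
  have hpk : (((p ^ k : ℕ) : ℤ) : 𝓞 F) ∈ v.asIdeal ^ (2 * k) := by
    rw [Int.cast_natCast, Nat.cast_pow, pow_mul]
    exact Ideal.pow_mem_pow (natCast_mem_sq_of_ramificationIdx_eq_two v hp hv he) k
  -- (ii) the base map `ℤ/p^k → 𝓞_F/𝔭^{2k}`
  let i : ℤ ⧸ Ideal.span {((p ^ k : ℕ) : ℤ)} →+* 𝓞 F ⧸ v.asIdeal ^ (2 * k) :=
    Ideal.Quotient.lift _ ((Ideal.Quotient.mk _).comp (algebraMap ℤ (𝓞 F))) (by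
      intro a ha
      obtain ⟨b, rfl⟩ := Ideal.mem_span_singleton'.mp ha
      rw [RingHom.comp_apply, map_mul, map_mul, eq_intCast (algebraMap ℤ (𝓞 F)) ((p ^ k : ℕ) : ℤ),
        Ideal.Quotient.eq_zero_iff_mem.mpr hpk, mul_zero])
  have hi : ∀ n : ℤ, i (Ideal.Quotient.mk _ n) = (n : 𝓞 F ⧸ v.asIdeal ^ (2 * k)) := fun n => by
    change Ideal.Quotient.lift _ _ _ (Ideal.Quotient.mk _ n) = _
    rw [Ideal.Quotient.lift_mk, RingHom.comp_apply, eq_intCast, map_intCast]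
  -- (iii) `θ̄² = c̄`
  have hroot : (X ^ 2 - C (Ideal.Quotient.mk (Ideal.span {((p ^ k : ℕ) : ℤ)}) c)).eval₂ i
      (Ideal.Quotient.mk _ θ) = 0 := by
    rw [eval₂_sub, eval₂_X_pow, eval₂_C, hi, ← map_intCast (Ideal.Quotient.mk (v.asIdeal ^ (2 * k))) c,
      ← map_pow, ← map_sub, Ideal.Quotient.eq_zero_iff_mem]
    exact hθ
  let ψ : AdjoinRoot (X ^ 2 - C (Ideal.Quotient.mk (Ideal.span {((p ^ k : ℕ) : ℤ)}) c)) →+*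
      𝓞 F ⧸ v.asIdeal ^ (2 * k) := AdjoinRoot.lift i _ hroot
  have hψroot : ψ (AdjoinRoot.root _) = Ideal.Quotient.mk _ θ := AdjoinRoot.lift_root hroot
  have hψint : ∀ n : ℤ, ψ n = n := fun n => map_intCast ψ n
  -- (iv) surjectivity: `𝓞_F/𝔭^{2k} = ℤ[θ̄ - t]`
  have hres := exists_intCast_sub_mem_of_absNorm_eq v hp (absNorm_eq_of_inertiaDeg_eq_one v hp hv hf) hv
  have hsurj : Function.Surjective ψ := by
    intro y
    obtain ⟨x, rfl⟩ := Ideal.Quotient.mk_surjective y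
    obtain ⟨P, hP⟩ := exists_poly_sub_mem_pow v hres hu1 hu2 (2 * k) x
    refine ⟨P.eval₂ (Int.castRingHom _)
      (AdjoinRoot.root (X ^ 2 - C (Ideal.Quotient.mk (Ideal.span {((p ^ k : ℕ) : ℤ)}) c))
        - ((t : ℤ) : AdjoinRoot (X ^ 2 - C (Ideal.Quotient.mk (Ideal.span {((p ^ k : ℕ) : ℤ)}) c)))), ?_⟩
    have h1 : Ideal.Quotient.mk (v.asIdeal ^ (2 * k)) x
        = Ideal.Quotient.mk (v.asIdeal ^ (2 * k)) (aeval (θ - (t : 𝓞 F)) P) := by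
      rw [Ideal.Quotient.eq]; exact hP
    rw [Polynomial.hom_eval₂, map_sub, hψroot, map_intCast, h1, aeval_def, Polynomial.hom_eval₂, map_sub,
      map_intCast]
    congr 1
    exact RingHom.ext_int _ _
  -- (v) counting: both sides have `p^{2k}` elements
  haveI : NeZero (p ^ k) := ⟨by positivity⟩
  haveI : Finite (AdjoinRoot (X ^ 2 - C (Ideal.Quotient.mk (Ideal.span {((p ^ k : ℕ) : ℤ)}) c))) := by
    haveI : Finite (ℤ ⧸ Ideal.span {((p ^ k : ℕ) : ℤ)}) :=
      Finite.of_equiv _ (Int.quotientSpanNatEquivZMod (p ^ k)).toEquiv.symm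
    exact Finite.of_equiv _ (AdjoinRoot.powerBasis' (monic_X_sq_sub_C'
      (Ideal.Quotient.mk (Ideal.span {((p ^ k : ℕ) : ℤ)}) c))).basis.equivFun.toEquiv.symm
  have hcardB := natCard_adjoinRoot_sq_sub hq1 (Ideal.Quotient.mk (Ideal.span {((p ^ k : ℕ) : ℤ)}) c)
  have hcardQ : Nat.card (𝓞 F ⧸ v.asIdeal ^ (2 * k)) = (p ^ k) ^ 2 := by
    rw [natCard_quotient_pow_eq v hp hv hf, ← pow_mul]; ring_nf
  have hbij : Function.Bijective ψ := hsurj.bijective_of_nat_card_le (by rw [hcardB, hcardQ])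
  exact ⟨RingEquiv.ofBijective ψ hbij, hψroot, hψint⟩

end Literature.NumberTheory.NumberFields
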